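import Literature.MathematicalPhysics.QuantumFieldTheory.Balaban1983to89.B9C2FormMajTorusLettersY
import Literature.MathematicalPhysics.QuantumFieldTheory.Balaban1983to89.Node00.OpsYC2OfRecord
import Literature.MathematicalPhysics.QuantumFieldTheory.Balaban1983to89.Node00.OpsYBondMapOfRecord

/-!
# `Balaban1983to89.B9C2FormMajTorusLettersAtMemberY` — [B9] (3.136)–(3.137) pp. 422–423 at print's class (3.35) p. 396: **THE N06 LETTER `hC2` FOR THE TORUS
# READING OF [5]'s `C⁽²⁾`, IN THE CERTIFICATE'S BINDER TEXT** — threshold form (`M·α₀ ≤ a`), the certificate's weight `w_C(c) = (Lʲη)_c·n_c⁻¹`, the member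
# currency (`MemberY`, `geo9Y`, `bg9YP`, `G = SU(N)`)

T. Bałaban, *Propagators for lattice gauge theories in a background field*, Commun. Math. Phys. **99** (1985) 389–434 [`Balaban1985BackgroundPropagators`, "B9"];
[5] = [B7] = T. Bałaban, *Averaging operations for lattice gauge theories*, Commun. Math. Phys. **98** (1985) 17–51 [`Balaban1985Averaging`].
statement-level skeleton of published theorems with citation tags; proofs where landed; nothing here is a claim about the Yang–Mills mass gap.

THE PRINT.  [B9] pp. 422–423: *«The inequality (149) in [5] implies … |(Δ⁽²⁾A)(b)| ≦ O(1)Mα₀(Lʲη)⁻²|A| …»* for `U` in the class (3.35) p. 396 («The number α₀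
characterizes this class of configurations. We will need α₀ so small that O(1)Mα₀ is still a sufficiently small number»).

WHY THIS FILE (seat dag-n06-l g34, programme P-C2, after the ASSEMBLY `B9C2FormMajTorusLettersY.c2FormMaj_of_torusLetters`).  The N06 certificate displays
`hC2 : ∀ x, M₁₂ ≤ (geo9Y x).M → ∀ α₀, 0 < α₀ → (geo9Y x).M * α₀ ≤ a₁₂ → ∀ U, Reg335 c α₀ U → Reg336 c α₀ U → C2FormMaj x.toKIdx (g := geo9Y x) (bI x) id (𝔠 x).form U κ_C δ_C2
(fun c => (geo9Y x).len c * ((L^{d+1})^{lvl c})⁻¹)`.  The assembly proves the letter at a k-level index from `K_pl(Mα₀)·L⁴ < α₀′` and a budget in the raw weights `w`.  This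
file rewrites it (i) in THRESHOLD form — `K_pl` is monotone, so `M·α₀ ≤ a` and ONE numeric inequality `K_pl(a)·L⁴ < α₀′` suffice; (ii) with the certificate's weight
`w_C = len·n⁻¹` and a budget split as `‖w c‖·(L^{j(c)})² ≤ ω·len c` (the pin's scalar: def-Y's `norm_wC2OfRecord_mul_sq`, `ω = ½`) and ONE numeric inequality
`ω·C₃·e^{2δ_C(ℓ+4)} ≤ κ_C`; (iii) in the member currency with `G = SU(N) ≤ U(N)` and print's class in P-currency (`bg9YP`, the certificate's `hRP1`).

WHAT THIS FILE PROVES (0 sorry; theorems only).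
* §1 `Kpl_mono` (monotonicity of the plaquette constant of `B9C2FormBoxRegimeY`), `kGeo_M_nonneg`, `pow_lvl_pow_comm` (bookkeeping; the length facts are cited: `B6KLevelCensusIndexV1.len_pos`, `B9GeoNormsKLevelV1.geo9K_len_kGeo`).
* §2 ★★ `c2FormMaj_of_torusLetters_threshold` — the assembly in threshold form with the certificate's weight, at a k-level index, `G ≤ U(N)`.
* §3 ★★★ `c2FormMaj_of_torusLetters_member` (+ `_half`: the pin's scalar `‖w c‖·(L^{j})² = len c∕2` verbatim, `C₃e^{2δ_C(ℓ+4)} ≤ 2κ_C`) — IN THE CERTIFICATE'S BINDER TEXT: `∀ α₀, 0 < α₀ → (geo9Y x).M * α₀ ≤ a → ∀ U, (bg9YP (M_N ℂ) SU(N) x).Reg335 c₀ α₀ U →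
  C2FormMaj x.toKIdx (g := geo9Y x) bI id ((c2LettersOfRawY x.toKIdx (rawFormY x.toKIdx w)).form U) κ_C δ_C (fun c => (geo9Y x).len c * ((L^{d+1})^{lvl c})⁻¹)`.
* §4 ★★★ `c2FormMaj_c2YOfRecord_of_hβ1` ∕ `c2FormMaj_c2YOfRecord` — AT THE PINS `𝔠 := c2YOfRecord N θ M⋆` (def-Y, `Node00.OpsYC2OfRecord`: its scalar
  `norm_wC2OfRecord_mul_sq_member` consumed by name) and `bI := bIYOfRecord θ M⋆` (`Node00.OpsYBondMapOfRecord.bIYOfRecord_hβ1`): the certificate's `hC2` binder with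
  `𝔠`, `bI` pinned, up to its unused `M₁₂ ≤ M` and `Reg336` antecedents, from the numerics alone.
NOT CLAIMED: the choice of the numerics (n06-d's fold displays them: `α₀′ bb` and the eight inequalities of §2 + `hκ2`); `IsCov` of the letter (sequel).
-/

noncomputable section

open scoped BigOperators Matrix.Norms.L2Operator

namespace Literature.MathematicalPhysics.QuantumFieldTheory.Balaban1983to89.B9C2FormMajTorusLettersAtMemberY

open Node00 (CfgY FBondY IBondY C2LettersY)
open B6KLevelCensusIndexV1 (KIdx kGeo)
open B6GlobalChartV1 (PV blkV1)
open B6Ineq2142KLevelV1 (lvl β)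
open B7Prop2Explicit (unitaryUnits C0 c2')
open B7Prop2SpecialUnitary (specialUnitaryUnits specialUnitaryUnits_le_unitaryUnits)
open B7Prop3Flat (c3)
open B7Prop5GeneralLevels (C3Gen thetaGen C1ppGen)
open B9C2LettersTorusY (rawFormY)
open B9C2LettersRealSymm (c2LettersOfRawY)
open B9C2FormBoxRegimeY (Kpl Kpl_nonneg)
open B9C2FormMajTorusLettersY (c2FormMaj_of_torusLetters)
open B9Delta2FormMajorant (C2FormMaj)
open B9BackgroundsKLevelV1P (bg9KP bg9YP)
open B9GeoNormsKLevelV1 (geo9K)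
open B9PinMembersKLevelV1 (MemberY geo9Y)
open B6Geom246MultiLevelTorus (geomT)

variable {d ℓ : ℕ} {hd : 1 ≤ d + 1} {hL : Odd (ℓ + 1) ∧ 1 < ℓ + 1} {b₀ b₁ : ℝ}
variable (i : KIdx d ℓ hd hL b₀ b₁) {N : ℕ} [Nonempty (Fin N)]

/-! ## §1 Bookkeeping -/

omit [Nonempty (Fin N)] in
/-- the plaquette constant `K_pl(t) = 2(10Lt)(1+10Lt)e^{4·10Lt}` is monotone in `t ≥ 0`. [cite: Balaban1985BackgroundPropagators, (3.35) p.396, bookkeeping] -/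
theorem Kpl_mono {s t : ℝ} (hs : 0 ≤ s) (hst : s ≤ t) : Kpl i s ≤ Kpl i t := by
  have hL : 0 ≤ (kGeo i).L := by rw [show (kGeo i).L = ((ℓ + 1 : ℕ) : ℝ) from rfl]; positivity
  have h1 : 10 * (kGeo i).L * s ≤ 10 * (kGeo i).L * t := mul_le_mul_of_nonneg_left hst (by positivity)
  have h0 : 0 ≤ 10 * (kGeo i).L * s := by positivity
  unfold Kpl
  have h2 : 1 + 10 * (kGeo i).L * s ≤ 1 + 10 * (kGeo i).L * t := by linarith
  have h3 : Real.exp (4 * (10 * (kGeo i).L * s)) ≤ Real.exp (4 * (10 * (kGeo i).L * t)) := Real.exp_le_exp.2 (by linarith)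
  have h4 : 2 * (10 * (kGeo i).L * s) ≤ 2 * (10 * (kGeo i).L * t) := by linarith
  have h5 : 0 ≤ 1 + 10 * (kGeo i).L * s := by linarith
  have h6 : 0 ≤ 2 * (10 * (kGeo i).L * t) := by linarith
  have h7 : 0 ≤ 2 * (10 * (kGeo i).L * t) * (1 + 10 * (kGeo i).L * t) := mul_nonneg h6 (by linarith)
  exact mul_le_mul (mul_le_mul h4 h2 h5 h6) h3 (Real.exp_pos _).le h7

omit [Nonempty (Fin N)] in
/-- `0 ≤ M = L·M_h`. [cite: Balaban1984PropagatorsII, (2.2) p.224, bookkeeping] -/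
theorem kGeo_M_nonneg : 0 ≤ (kGeo i).M := by
  rw [show (kGeo i).M = ((ℓ + 1 : ℕ) : ℝ) * (i.Mh : ℝ) from rfl]; positivity

omit [Nonempty (Fin N)] in
/-- `(L^j)^{d+1} = (L^{d+1})^j` across the two spellings of `L`. [cite: Balaban1984PropagatorsII, (2.2) p.224, bookkeeping] -/
theorem pow_lvl_pow_comm (j : ℕ) : (((ℓ : ℝ) + 1) ^ j) ^ (d + 1) = ((((ℓ + 1 : ℕ) : ℝ)) ^ (d + 1)) ^ j := by
  rw [← pow_mul, ← pow_mul, mul_comm]; push_cast; ring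

/-! ## §2 Threshold form with the certificate's weight, at a k-level index -/

/-- ★★ **THRESHOLD FORM WITH THE CERTIFICATE'S WEIGHT**: at a k-level index `i`, `G ≤ U(N)`, print's class (3.35) (`bg9KP`, `c₀ ≤ 10`) at `(α₀, U)` with `M·α₀ ≤ a`,
[B7]'s window keyed to the threshold (`K_pl(a)·L⁴ < α₀′`, `C₀α₀′ ≤ ⅓`, `4α₀′ ≤ c₂′`, Prop.-4∕(145)∕(155) smallness at radius `b₀`), raw weights with
`‖w c‖·(L^{j(c)})² ≤ ω·(Lʲη)_c` and `ω·C₃·e^{2δ_C(ℓ+4)} ≤ κ_C`:  the letter `C2FormMaj` for the generated form at the certificate's weight `w_C(c) = (Lʲη)_c·(L^{d+1})^{−j(c)}`.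
[cite: Balaban1985BackgroundPropagators, (3.136)–(3.137) pp.422–423, (3.35) p.396] [cite: Balaban1985Averaging, (149) p.40, (52) p.26] -/
theorem c2FormMaj_of_torusLetters_threshold {G : Subgroup (Matrix (Fin N) (Fin N) ℂ)ˣ}
    (hGU : G ≤ unitaryUnits (Matrix (Fin N) (Fin N) ℂ)) {c₀ : ℝ} (hc : c₀ ≤ 10) {a α₀' : ℝ}
    (hKa : Kpl i a * (kGeo i).L ^ 4 < α₀')
    (hα3 : C0 (d + 1) * α₀' ≤ 1 / 3) (hα4 : 4 * α₀' ≤ c2' (d + 1) (ℓ + 1))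
    {bb : ℝ} (hbb : 0 < bb)
    (hsmall : Real.exp (4 * (800 * (((d + 1 : ℕ) : ℝ) + 1) ^ 2 * (((d + 1 : ℕ) : ℝ) + 4)) * α₀') * (1 + 8 * (131072 * (((d + 1 : ℕ) : ℝ) + 1) ^ 2) * bb) ≤ 2)
    (hc₃ : 4 * bb < c3 (d + 1) (ℓ + 1))
    (h145 : 8 * ((d + 1 : ℕ) : ℝ) * thetaGen (d + 1) (ℓ + 1) α₀' * ((ℓ : ℝ) + 1)⁻¹ ^ 4 ≤ 1)
    (h155 : (2 * ((ℓ : ℝ) + 1) - 1) * ((ℓ : ℝ) + 1)⁻¹ ^ 2 + 2 * ((d + 1 : ℕ) : ℝ) * thetaGen (d + 1) (ℓ + 1) α₀' * ((ℓ : ℝ) + 1)⁻¹ ^ 3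
      + 1 / 8 * (1 + 2 * ((d + 1 : ℕ) : ℝ) * thetaGen (d + 1) (ℓ + 1) α₀' * ((ℓ : ℝ) + 1)⁻¹ ^ 2 + 2 * ((d + 1 : ℕ) : ℝ) * C3Gen (d + 1) (ℓ + 1) * bb) * ((ℓ : ℝ) + 1)⁻¹ ^ 2 ≤ 1)
    {bI : FBondY i → IBondY i} (hβ1 : ∀ f : FBondY i, (geomT i.D).dist (β i.hN i.D i.hk (bI f)) (blkV1 i.hN i.D f) ≤ 1)
    (w : IBondY i → ℂ) {ω : ℝ} (hw : ∀ c : IBondY i, ‖w c‖ * ((((ℓ + 1 : ℕ) : ℝ)) ^ lvl i.hN i.D i.hk c) ^ 2 ≤ ω * (geo9K i).len c)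
    {κC δC : ℝ} (hδC : 0 ≤ δC) (hκ : ω * C3Gen (d + 1) (ℓ + 1) * Real.exp (2 * δC * ((ℓ : ℝ) + 4)) ≤ κC)
    {α₀ : ℝ} (hα₀ : 0 ≤ α₀) (hMa : (kGeo i).M * α₀ ≤ a) {U : CfgY (Matrix (Fin N) (Fin N) ℂ) i}
    (hreg : (bg9KP (Matrix (Fin N) (Fin N) ℂ) G i).Reg335 c₀ α₀ U) :
    C2FormMaj i (g := geo9K i) bI (fun c => c) (c2LettersOfRawY i (rawFormY i w)).form U κC δC
      (fun c => (geo9K i).len c * ((((((ℓ + 1 : ℕ) : ℝ)) ^ (d + 1)) ^ lvl i.hN i.D i.hk c)⁻¹)) := by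
  have hℓ : 2 ≤ ℓ + 1 := hL.2
  have hMα : 0 ≤ (kGeo i).M * α₀ := mul_nonneg (kGeo_M_nonneg i) hα₀
  have hL4 : 0 ≤ (kGeo i).L ^ 4 := by rw [show (kGeo i).L = ((ℓ + 1 : ℕ) : ℝ) from rfl]; positivity
  have hK : Kpl i ((kGeo i).M * α₀) * (kGeo i).L ^ 4 < α₀' :=
    lt_of_le_of_lt (mul_le_mul_of_nonneg_right (Kpl_mono i hMα hMa) hL4) hKa
  have hC3 : 0 ≤ C3Gen (d + 1) (ℓ + 1) := by unfold C3Gen C1ppGen; positivity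
  refine c2FormMaj_of_torusLetters i hℓ hGU hc hMα hreg hK hα3 hα4 hbb hsmall hc₃ h145 h155 hβ1 w hδC ?_
  intro c
  have hLj : (0 : ℝ) < ((ℓ : ℝ) + 1) ^ lvl i.hN i.D i.hk c := by positivity
  have hn : 0 ≤ ((((ℓ : ℝ) + 1) ^ lvl i.hN i.D i.hk c) ^ (d + 1))⁻¹ := by positivity
  have he : 0 ≤ Real.exp (2 * δC * ((ℓ : ℝ) + 4)) := (Real.exp_pos _).le
  have hlen : 0 ≤ (geo9K i).len c := (B6KLevelCensusIndexV1.len_pos i c).le  -- `(geo9K i).len = (kGeo i).len` (`geo9K_len_kGeo`, rfl)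
  have hw' : ‖w c‖ * (((ℓ : ℝ) + 1) ^ lvl i.hN i.D i.hk c) ^ 2 ≤ ω * (geo9K i).len c := by
    have h := hw c; push_cast at h; exact h
  calc ‖w c‖ * (C3Gen (d + 1) (ℓ + 1) * (((ℓ : ℝ) + 1) ^ lvl i.hN i.D i.hk c) ^ 2) * ((((ℓ : ℝ) + 1) ^ lvl i.hN i.D i.hk c) ^ (d + 1))⁻¹ *
        Real.exp (2 * δC * ((ℓ : ℝ) + 4))
        = (‖w c‖ * (((ℓ : ℝ) + 1) ^ lvl i.hN i.D i.hk c) ^ 2) * (C3Gen (d + 1) (ℓ + 1) * ((((ℓ : ℝ) + 1) ^ lvl i.hN i.D i.hk c) ^ (d + 1))⁻¹ *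
            Real.exp (2 * δC * ((ℓ : ℝ) + 4))) := by ring
    _ ≤ (ω * (geo9K i).len c) * (C3Gen (d + 1) (ℓ + 1) * ((((ℓ : ℝ) + 1) ^ lvl i.hN i.D i.hk c) ^ (d + 1))⁻¹ * Real.exp (2 * δC * ((ℓ : ℝ) + 4))) :=
          mul_le_mul_of_nonneg_right hw' (by positivity)
    _ = (ω * C3Gen (d + 1) (ℓ + 1) * Real.exp (2 * δC * ((ℓ : ℝ) + 4))) * ((geo9K i).len c * ((((ℓ : ℝ) + 1) ^ lvl i.hN i.D i.hk c) ^ (d + 1))⁻¹) := by ring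
    _ ≤ κC * ((geo9K i).len c * ((((ℓ : ℝ) + 1) ^ lvl i.hN i.D i.hk c) ^ (d + 1))⁻¹) := mul_le_mul_of_nonneg_right hκ (mul_nonneg hlen hn)
    _ = κC * ((geo9K i).len c * ((((((ℓ + 1 : ℕ) : ℝ)) ^ (d + 1)) ^ lvl i.hN i.D i.hk c)⁻¹)) := by rw [pow_lvl_pow_comm]

/-! ## §3 The member currency: the certificate's binder text -/

/-- ★★★ **THE N06 LETTER `hC2` IN THE CERTIFICATE'S BINDER TEXT** (member `x`, `G = SU(N)`, print's class in P-currency `bg9YP`, thresholds): under [B7]'s window keyed to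
the threshold `a` and the two numeric inequalities `K_pl(a)·L⁴ < α₀′`, `ω·C₃·e^{2δ_C(ℓ+4)} ≤ κ_C`, for raw weights with `‖w c‖·(L^{j(c)})² ≤ ω·(geo9Y x).len c` and a
1-faithful block map `bI`:
`∀ α₀, 0 < α₀ → (geo9Y x).M * α₀ ≤ a → ∀ U, (bg9YP (M_N ℂ) SU(N) x).Reg335 c₀ α₀ U → C2FormMaj x.toKIdx (g := geo9Y x) bI id ((c2LettersOfRawY x.toKIdx (rawFormY x.toKIdx w)).form U) κ_C δ_C
(fun c => (geo9Y x).len c * ((L^{d+1})^{lvl c})⁻¹)`.  (The certificate's fold: `w := wC2OfRecord x.toKIdx`, `hw :=` def-Y's `norm_wC2OfRecord_mul_sq` with `ω = ½`,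
`hβ1 := bIYOfRecord_hβ1 θ M⋆ x`, `hreg := (hRP1 x α₀ U h).2`; the `Reg336` and `M₁₂ ≤ M` binders of `hC2` are not used.)
[cite: Balaban1985BackgroundPropagators, (3.136)–(3.137) pp.422–423, (3.35) p.396] [cite: Balaban1985Averaging, (149) p.40, (52) p.26] -/
theorem c2FormMaj_of_torusLetters_member {Mstar : ℕ} (x : MemberY d ℓ hd hL b₀ b₁ Mstar) {c₀ : ℝ} (hc : c₀ ≤ 10) {a α₀' : ℝ}
    (hKa : Kpl x.toKIdx a * (kGeo x.toKIdx).L ^ 4 < α₀')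
    (hα3 : C0 (d + 1) * α₀' ≤ 1 / 3) (hα4 : 4 * α₀' ≤ c2' (d + 1) (ℓ + 1))
    {bb : ℝ} (hbb : 0 < bb)
    (hsmall : Real.exp (4 * (800 * (((d + 1 : ℕ) : ℝ) + 1) ^ 2 * (((d + 1 : ℕ) : ℝ) + 4)) * α₀') * (1 + 8 * (131072 * (((d + 1 : ℕ) : ℝ) + 1) ^ 2) * bb) ≤ 2)
    (hc₃ : 4 * bb < c3 (d + 1) (ℓ + 1))
    (h145 : 8 * ((d + 1 : ℕ) : ℝ) * thetaGen (d + 1) (ℓ + 1) α₀' * ((ℓ : ℝ) + 1)⁻¹ ^ 4 ≤ 1)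
    (h155 : (2 * ((ℓ : ℝ) + 1) - 1) * ((ℓ : ℝ) + 1)⁻¹ ^ 2 + 2 * ((d + 1 : ℕ) : ℝ) * thetaGen (d + 1) (ℓ + 1) α₀' * ((ℓ : ℝ) + 1)⁻¹ ^ 3
      + 1 / 8 * (1 + 2 * ((d + 1 : ℕ) : ℝ) * thetaGen (d + 1) (ℓ + 1) α₀' * ((ℓ : ℝ) + 1)⁻¹ ^ 2 + 2 * ((d + 1 : ℕ) : ℝ) * C3Gen (d + 1) (ℓ + 1) * bb) * ((ℓ : ℝ) + 1)⁻¹ ^ 2 ≤ 1)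
    {bI : FBondY x.toKIdx → IBondY x.toKIdx} (hβ1 : ∀ f : FBondY x.toKIdx, (geomT x.D).dist (β x.hN x.D x.hk (bI f)) (blkV1 x.hN x.D f) ≤ 1)
    (w : IBondY x.toKIdx → ℂ) {ω : ℝ} (hw : ∀ c : IBondY x.toKIdx, ‖w c‖ * ((((ℓ + 1 : ℕ) : ℝ)) ^ lvl x.hN x.D x.hk c) ^ 2 ≤ ω * (geo9Y x).len c)
    {κC δC : ℝ} (hδC : 0 ≤ δC) (hκ : ω * C3Gen (d + 1) (ℓ + 1) * Real.exp (2 * δC * ((ℓ : ℝ) + 4)) ≤ κC) :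
    ∀ α₀ : ℝ, 0 < α₀ → (geo9Y x).M * α₀ ≤ a → ∀ U : CfgY (Matrix (Fin N) (Fin N) ℂ) x.toKIdx,
      (bg9YP (Matrix (Fin N) (Fin N) ℂ) (specialUnitaryUnits (Fin N)) x).Reg335 c₀ α₀ U →
        C2FormMaj x.toKIdx (g := geo9Y x) bI (fun c => c) (c2LettersOfRawY x.toKIdx (rawFormY x.toKIdx w)).form U κC δC
          (fun c => (geo9Y x).len c * ((((((ℓ + 1 : ℕ) : ℝ)) ^ (d + 1)) ^ lvl x.hN x.D x.hk c)⁻¹)) :=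
  fun _α₀ hα₀ hMa _U hreg =>
    c2FormMaj_of_torusLetters_threshold x.toKIdx (specialUnitaryUnits_le_unitaryUnits (n := Fin N)) hc hKa hα3 hα4 hbb hsmall hc₃ h145 h155
      hβ1 w hw hδC hκ hα₀.le hMa hreg.1

/-- ★★★ **THE SAME AT THE PIN'S SCALAR** `‖w c‖·(L^{j(c)})² = (geo9Y x).len c ∕ 2` (def-Y's `norm_wC2OfRecord_mul_sq_member`, verbatim as the hypothesis `hw2`) and the
one numeric inequality `C₃·e^{2δ_C(ℓ+4)} ≤ 2κ_C`. [cite: Balaban1985BackgroundPropagators, (3.136)–(3.137) pp.422–423, p.421, (3.35) p.396] [cite: Balaban1985Averaging, (149) p.40] -/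
theorem c2FormMaj_of_torusLetters_member_half {Mstar : ℕ} (x : MemberY d ℓ hd hL b₀ b₁ Mstar) {c₀ : ℝ} (hc : c₀ ≤ 10) {a α₀' : ℝ}
    (hKa : Kpl x.toKIdx a * (kGeo x.toKIdx).L ^ 4 < α₀')
    (hα3 : C0 (d + 1) * α₀' ≤ 1 / 3) (hα4 : 4 * α₀' ≤ c2' (d + 1) (ℓ + 1))
    {bb : ℝ} (hbb : 0 < bb)
    (hsmall : Real.exp (4 * (800 * (((d + 1 : ℕ) : ℝ) + 1) ^ 2 * (((d + 1 : ℕ) : ℝ) + 4)) * α₀') * (1 + 8 * (131072 * (((d + 1 : ℕ) : ℝ) + 1) ^ 2) * bb) ≤ 2)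
    (hc₃ : 4 * bb < c3 (d + 1) (ℓ + 1))
    (h145 : 8 * ((d + 1 : ℕ) : ℝ) * thetaGen (d + 1) (ℓ + 1) α₀' * ((ℓ : ℝ) + 1)⁻¹ ^ 4 ≤ 1)
    (h155 : (2 * ((ℓ : ℝ) + 1) - 1) * ((ℓ : ℝ) + 1)⁻¹ ^ 2 + 2 * ((d + 1 : ℕ) : ℝ) * thetaGen (d + 1) (ℓ + 1) α₀' * ((ℓ : ℝ) + 1)⁻¹ ^ 3
      + 1 / 8 * (1 + 2 * ((d + 1 : ℕ) : ℝ) * thetaGen (d + 1) (ℓ + 1) α₀' * ((ℓ : ℝ) + 1)⁻¹ ^ 2 + 2 * ((d + 1 : ℕ) : ℝ) * C3Gen (d + 1) (ℓ + 1) * bb) * ((ℓ : ℝ) + 1)⁻¹ ^ 2 ≤ 1)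
    {bI : FBondY x.toKIdx → IBondY x.toKIdx} (hβ1 : ∀ f : FBondY x.toKIdx, (geomT x.D).dist (β x.hN x.D x.hk (bI f)) (blkV1 x.hN x.D f) ≤ 1)
    (w : IBondY x.toKIdx → ℂ) (hw2 : ∀ c : IBondY x.toKIdx, ‖w c‖ * ((((ℓ + 1 : ℕ) : ℝ)) ^ lvl x.hN x.D x.hk c) ^ 2 = (geo9Y x).len c / 2)
    {κC δC : ℝ} (hδC : 0 ≤ δC) (hκ2 : C3Gen (d + 1) (ℓ + 1) * Real.exp (2 * δC * ((ℓ : ℝ) + 4)) ≤ 2 * κC) :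
    ∀ α₀ : ℝ, 0 < α₀ → (geo9Y x).M * α₀ ≤ a → ∀ U : CfgY (Matrix (Fin N) (Fin N) ℂ) x.toKIdx,
      (bg9YP (Matrix (Fin N) (Fin N) ℂ) (specialUnitaryUnits (Fin N)) x).Reg335 c₀ α₀ U →
        C2FormMaj x.toKIdx (g := geo9Y x) bI (fun c => c) (c2LettersOfRawY x.toKIdx (rawFormY x.toKIdx w)).form U κC δC
          (fun c => (geo9Y x).len c * ((((((ℓ + 1 : ℕ) : ℝ)) ^ (d + 1)) ^ lvl x.hN x.D x.hk c)⁻¹)) :=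
  c2FormMaj_of_torusLetters_member x hc hKa hα3 hα4 hbb hsmall hc₃ h145 h155 hβ1 w (ω := 1 / 2)
    (fun c => by rw [hw2 c]; exact le_of_eq (by ring)) hδC (by linarith)

/-! ## §4 At the record: the pins `c2YOfRecord` (def-Y, `Node00.OpsYC2OfRecord`) and `bIYOfRecord` (`Node00.OpsYBondMapOfRecord`) -/

section Record

open Node00 (Stage3Params wC2OfRecord c2YOfRecord norm_wC2OfRecord_mul_sq_member)
open Node00.OpsYBondMapOfRecord (bIYOfRecord bIYOfRecord_hβ1)

variable (θ : Stage3Params) (Mstar : ℕ)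

omit [Nonempty (Fin N)] in
/-- `K_pl(a)·L⁴` at a member of the record, UNFOLDED and member-free: `2(10La)(1+10La)e^{40La}·L⁴`, `L = ℓ₆ + 1`. [cite: Balaban1985BackgroundPropagators, (3.35) p.396, bookkeeping] -/
theorem Kpl_mul_L4_eq (x : MemberY θ.d₆ θ.ℓ₆ θ.hd' θ.hL' θ.b₀ θ.b₁ Mstar) (a : ℝ) :
    Kpl x.toKIdx a * (kGeo x.toKIdx).L ^ 4 =
      2 * (10 * ((θ.ℓ₆ : ℝ) + 1) * a) * (1 + 10 * ((θ.ℓ₆ : ℝ) + 1) * a) * Real.exp (4 * (10 * ((θ.ℓ₆ : ℝ) + 1) * a)) * ((θ.ℓ₆ : ℝ) + 1) ^ 4 := by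
  unfold Kpl; rw [show (kGeo x.toKIdx).L = ((θ.ℓ₆ + 1 : ℕ) : ℝ) from rfl]; push_cast; ring_nf

/-- ★★★ **THE CERTIFICATE'S `hC2` AT THE FORM LETTER OF RECORD, block map free** (`𝔠 := c2YOfRecord N θ M⋆`, its scalar `‖w c‖·(L^j)² = len c∕2` consumed by name; a
1-faithful `bI`): under [B7]'s window keyed to the threshold `a` — the member-free numerics `2(10La)(1+10La)e^{40La}·L⁴ < α₀′` (= `K_pl(a)·L⁴`, `Kpl_mul_L4_eq`),
`C₀α₀′ ≤ ⅓`, `4α₀′ ≤ c₂′`, Prop.-4∕(145)∕(155) smallness at radius `b₀`, and `C₃·e^{2δ_C(ℓ+4)} ≤ 2κ_C`: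
`∀ α₀, 0 < α₀ → (geo9Y x).M * α₀ ≤ a → ∀ U, (bg9YP (M_N ℂ) SU(N) x).Reg335 c₀ α₀ U → C2FormMaj x.toKIdx (g := geo9Y x) bI id (c2YOfRecord N θ M⋆ x).form U κ_C δ_C (len·((L^{d+1})^{lvl})⁻¹)`.
[cite: Balaban1985BackgroundPropagators, (3.136)–(3.137) pp.422–423, p.421, (3.35) p.396] [cite: Balaban1985Averaging, (149) p.40, (52) p.26] -/
theorem c2FormMaj_c2YOfRecord_of_hβ1 (x : MemberY θ.d₆ θ.ℓ₆ θ.hd' θ.hL' θ.b₀ θ.b₁ Mstar) {c₀ : ℝ} (hc : c₀ ≤ 10) {a α₀' : ℝ}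
    (hKa : 2 * (10 * ((θ.ℓ₆ : ℝ) + 1) * a) * (1 + 10 * ((θ.ℓ₆ : ℝ) + 1) * a) * Real.exp (4 * (10 * ((θ.ℓ₆ : ℝ) + 1) * a)) * ((θ.ℓ₆ : ℝ) + 1) ^ 4 < α₀')
    (hα3 : C0 (θ.d₆ + 1) * α₀' ≤ 1 / 3) (hα4 : 4 * α₀' ≤ c2' (θ.d₆ + 1) (θ.ℓ₆ + 1))
    {bb : ℝ} (hbb : 0 < bb)
    (hsmall : Real.exp (4 * (800 * (((θ.d₆ + 1 : ℕ) : ℝ) + 1) ^ 2 * (((θ.d₆ + 1 : ℕ) : ℝ) + 4)) * α₀') * (1 + 8 * (131072 * (((θ.d₆ + 1 : ℕ) : ℝ) + 1) ^ 2) * bb) ≤ 2)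
    (hc₃ : 4 * bb < c3 (θ.d₆ + 1) (θ.ℓ₆ + 1))
    (h145 : 8 * ((θ.d₆ + 1 : ℕ) : ℝ) * thetaGen (θ.d₆ + 1) (θ.ℓ₆ + 1) α₀' * ((θ.ℓ₆ : ℝ) + 1)⁻¹ ^ 4 ≤ 1)
    (h155 : (2 * ((θ.ℓ₆ : ℝ) + 1) - 1) * ((θ.ℓ₆ : ℝ) + 1)⁻¹ ^ 2 + 2 * ((θ.d₆ + 1 : ℕ) : ℝ) * thetaGen (θ.d₆ + 1) (θ.ℓ₆ + 1) α₀' * ((θ.ℓ₆ : ℝ) + 1)⁻¹ ^ 3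
      + 1 / 8 * (1 + 2 * ((θ.d₆ + 1 : ℕ) : ℝ) * thetaGen (θ.d₆ + 1) (θ.ℓ₆ + 1) α₀' * ((θ.ℓ₆ : ℝ) + 1)⁻¹ ^ 2
        + 2 * ((θ.d₆ + 1 : ℕ) : ℝ) * C3Gen (θ.d₆ + 1) (θ.ℓ₆ + 1) * bb) * ((θ.ℓ₆ : ℝ) + 1)⁻¹ ^ 2 ≤ 1)
    {bI : FBondY x.toKIdx → IBondY x.toKIdx} (hβ1 : ∀ f : FBondY x.toKIdx, (geomT x.D).dist (β x.hN x.D x.hk (bI f)) (blkV1 x.hN x.D f) ≤ 1)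
    {κC δC : ℝ} (hδC : 0 ≤ δC) (hκ2 : C3Gen (θ.d₆ + 1) (θ.ℓ₆ + 1) * Real.exp (2 * δC * ((θ.ℓ₆ : ℝ) + 4)) ≤ 2 * κC) :
    ∀ α₀ : ℝ, 0 < α₀ → (geo9Y x).M * α₀ ≤ a → ∀ U : CfgY (Matrix (Fin N) (Fin N) ℂ) x.toKIdx,
      (bg9YP (Matrix (Fin N) (Fin N) ℂ) (specialUnitaryUnits (Fin N)) x).Reg335 c₀ α₀ U →
        C2FormMaj x.toKIdx (g := geo9Y x) bI (fun c => c) (c2YOfRecord N θ Mstar x).form U κC δC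
          (fun c => (geo9Y x).len c * ((((((θ.ℓ₆ + 1 : ℕ) : ℝ)) ^ (θ.d₆ + 1)) ^ lvl x.hN x.D x.hk c)⁻¹)) :=
  c2FormMaj_of_torusLetters_member_half x hc (by rw [Kpl_mul_L4_eq θ Mstar x a]; exact hKa) hα3 hα4 hbb hsmall hc₃ h145 h155 hβ1
    (wC2OfRecord x.toKIdx) (norm_wC2OfRecord_mul_sq_member x) hδC hκ2

/-- ★★★ **THE CERTIFICATE'S `hC2` AT BOTH PINS** (`𝔠 := c2YOfRecord N θ M⋆`, `bI := bIYOfRecord θ M⋆`): the same with `hβ1 := bIYOfRecord_hβ1 θ M⋆ x` — after the certificate's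
`subst hbI` this is its `hC2` binder up to the unused `M₁₂ ≤ (geo9Y x).M` and `Reg336` antecedents.
[cite: Balaban1985BackgroundPropagators, (3.136)–(3.137) pp.422–423, p.421, (3.35) p.396, (3.41) p.397] [cite: Balaban1985Averaging, (149) p.40, (52) p.26] -/
theorem c2FormMaj_c2YOfRecord (x : MemberY θ.d₆ θ.ℓ₆ θ.hd' θ.hL' θ.b₀ θ.b₁ Mstar) {c₀ : ℝ} (hc : c₀ ≤ 10) {a α₀' : ℝ}
    (hKa : 2 * (10 * ((θ.ℓ₆ : ℝ) + 1) * a) * (1 + 10 * ((θ.ℓ₆ : ℝ) + 1) * a) * Real.exp (4 * (10 * ((θ.ℓ₆ : ℝ) + 1) * a)) * ((θ.ℓ₆ : ℝ) + 1) ^ 4 < α₀')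
    (hα3 : C0 (θ.d₆ + 1) * α₀' ≤ 1 / 3) (hα4 : 4 * α₀' ≤ c2' (θ.d₆ + 1) (θ.ℓ₆ + 1))
    {bb : ℝ} (hbb : 0 < bb)
    (hsmall : Real.exp (4 * (800 * (((θ.d₆ + 1 : ℕ) : ℝ) + 1) ^ 2 * (((θ.d₆ + 1 : ℕ) : ℝ) + 4)) * α₀') * (1 + 8 * (131072 * (((θ.d₆ + 1 : ℕ) : ℝ) + 1) ^ 2) * bb) ≤ 2)
    (hc₃ : 4 * bb < c3 (θ.d₆ + 1) (θ.ℓ₆ + 1))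
    (h145 : 8 * ((θ.d₆ + 1 : ℕ) : ℝ) * thetaGen (θ.d₆ + 1) (θ.ℓ₆ + 1) α₀' * ((θ.ℓ₆ : ℝ) + 1)⁻¹ ^ 4 ≤ 1)
    (h155 : (2 * ((θ.ℓ₆ : ℝ) + 1) - 1) * ((θ.ℓ₆ : ℝ) + 1)⁻¹ ^ 2 + 2 * ((θ.d₆ + 1 : ℕ) : ℝ) * thetaGen (θ.d₆ + 1) (θ.ℓ₆ + 1) α₀' * ((θ.ℓ₆ : ℝ) + 1)⁻¹ ^ 3
      + 1 / 8 * (1 + 2 * ((θ.d₆ + 1 : ℕ) : ℝ) * thetaGen (θ.d₆ + 1) (θ.ℓ₆ + 1) α₀' * ((θ.ℓ₆ : ℝ) + 1)⁻¹ ^ 2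
        + 2 * ((θ.d₆ + 1 : ℕ) : ℝ) * C3Gen (θ.d₆ + 1) (θ.ℓ₆ + 1) * bb) * ((θ.ℓ₆ : ℝ) + 1)⁻¹ ^ 2 ≤ 1)
    {κC δC : ℝ} (hδC : 0 ≤ δC) (hκ2 : C3Gen (θ.d₆ + 1) (θ.ℓ₆ + 1) * Real.exp (2 * δC * ((θ.ℓ₆ : ℝ) + 4)) ≤ 2 * κC) :
    ∀ α₀ : ℝ, 0 < α₀ → (geo9Y x).M * α₀ ≤ a → ∀ U : CfgY (Matrix (Fin N) (Fin N) ℂ) x.toKIdx,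
      (bg9YP (Matrix (Fin N) (Fin N) ℂ) (specialUnitaryUnits (Fin N)) x).Reg335 c₀ α₀ U →
        C2FormMaj x.toKIdx (g := geo9Y x) (bIYOfRecord θ Mstar x) (fun c => c) (c2YOfRecord N θ Mstar x).form U κC δC
          (fun c => (geo9Y x).len c * ((((((θ.ℓ₆ + 1 : ℕ) : ℝ)) ^ (θ.d₆ + 1)) ^ lvl x.hN x.D x.hk c)⁻¹)) :=
  c2FormMaj_c2YOfRecord_of_hβ1 θ Mstar x hc hKa hα3 hα4 hbb hsmall hc₃ h145 h155 (bIYOfRecord_hβ1 θ Mstar x) hδC hκ2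

end Record

end Literature.MathematicalPhysics.QuantumFieldTheory.Balaban1983to89.B9C2FormMajTorusLettersAtMemberY
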